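import Mathlib
import HarnessLib
import Summits.HubbardSuperconductivity.HubbardSuperconductivity.Theorems.KLProgrammeKLRegimeTwoVolumeScaleZeroSpLegData
import Summits.HubbardSuperconductivity.HubbardSuperconductivity.Theorems.KLProgrammeKLRegimeTwoVolumeSectionalMomentScaleZero
import Summits.HubbardSuperconductivity.HubbardSuperconductivity.Theorems.KLProgrammeKLRegimeEngineScaleZeroE4PackageParts

/-!
# Route `KLProgramme` — crux K3, VL child `KLRegimeVolumeLimitV17F2` (stmt-HubbardSuperconductivity-20440), (vi) blueprint v4 M4b (data):
# ONE-VOLUME SCALE-`0` GRID DATA AT AN ADMISSIBLE FRAME `K` (the hypotheses of `hubbardGrid_sum_norm_kernel_twoVolume_stepZero_le`)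
# (cell gate-hubbard-kl, seat hubbard-kl-k3c4-p1 g11; `--supports` stmt-…-20440)

k3c5-p2's `…TwoVolumeScaleZeroSpLegData` §3 / `…ScaleZeroData` give the one-volume data of the scale-`0` two-volume step at the BARE frame
`K₀ = 0`; the own-top-frame induction (blueprint v4) reads them at each volume's top flow frame.  Every ingredient is frame-general already
(`rowSum_scaleZero_gridLabelWt_le_X5` at `FrameOK R U Nsc μ K`, `bareAlphaOne_le_klE3A1`, `…TwoVolumeDataKit`, `isGramBoundedR_scaleZero_of_frameOK_sharp`,
`isUnit_and_weightedProfile_of_gridData`), so this file is the frame-`K` twin, for `G_L^K = S_Lᵀ C^{K}_{>e₀} S_L` on the `2(2M)`-grid: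

* §1 rows at the registered thresholds (`klEngL₃ ≤ L`, `klEngM₃ ≤ M`, `|U| ≤ 1`, and the frame-depth condition `(Nsc+1)U² + 2|U| ≤ 3` that keeps p3's
  depth-`Nsc` constant within `klE3A1 R` — `frameAlphaOne_le_klE3A1`): `gridLabelWt`-weighted, `(1+tnorm)`-weighted, plain, `tnorm`- and
  REDUCED-`tnorm`-weighted (coarse residues mod `Lc ∣ L`, rows AND columns, also `1 + ·`), all `≤ (N/β)·klE3A1 R`; far tails `≤ ((N/β)·klE3A1 R)/(R′+1)`;
  sup entry `≤ 2(7+6047)` (`klBetaMin ≤ β ≤ L`).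
* §2 `frame_gridData` — Gram property (`κ₀ = √(2(7+6047))`), unit grid partition function and the `(1+diam_{tnorm})`-weighted pinned profile of
  `effAction G_L^K (V_N + 𝒩_K)` WITH the grid counterterm of the frame (vertex profile `Nv 1 = (|β|/N)·Σ_z‖Ǩ_L z‖(1+|z|)`, `Nv 2 = |U||β|/N`), given the
  `gridLabelWt`-weighted rows `≤ αw` and `θ = e·αw·normV(κ₀, ρ, Nv)/κ₀² < 1`; `vertexSlot_one_le_of_frameOK` bounds the counterterm slot by
  `(|β|/N)·(klKappaFrameC R·|U| + 12(Nsc+1)U²(…))` (`frameKernel_weightedL1_le`).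

Sorry-free; no definition.  References: BGM 2006 §2; Salmhofer 1998 Prop. 1.
-/

noncomputable section

namespace Summit.HubbardSuperconductivity.HubbardSuperconductivity.Theorems.TwoVolumeDefect

set_option linter.dupNamespace false -- summit = problem name (single-conjunct summit), D-0017

open Finset Literature.MathematicalPhysics.QuantumLattice GrassmannAlgebra Literature.Probability.LatticeModels
  Literature.Probability.LatticeModels.BattleFederbush
open Summit.HubbardSuperconductivity.HubbardSuperconductivity.Theorems.EngineV8
open Summit.HubbardSuperconductivity.HubbardSuperconductivity.Theorems.KLRegimeSplit

/-! ## §1 Rows, columns, tails and the sup entry of `G_L^K` at an admissible frame -/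

section Rows

variable {L M : ℕ} [NeZero L] [NeZero M] {R : RenConsts} {U μ β : ℝ} {Nsc : ℕ} {K : TrigPolyC4v}

omit [NeZero L] [NeZero M] in
/-- **p3's depth-`Nsc` row constant is `≤ klE3A1 R`** whenever `(Nsc+1)U² + 2|U| ≤ 3` (the bare case `Nsc = 0`, `|U| ≤ 1` is
`bareAlphaOne_le_klE3A1`; in the regime `Nsc = nScales β ≤ c/(U² ln 4)` the condition is a smallness of `c`). -/
theorem frameAlphaOne_le_klE3A1 (R : RenConsts) (hNU : ((Nsc : ℝ) + 1) * U ^ 2 + 2 * |U| ≤ 3) :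
    klScaleZeroA0 + uvTimeMomentConst klE0 7 32 +
          2 * (uvSpaceMomentConst klE0 1 (uvPieceSq klE0 (uvBaseQ klCutoffX5 klE0 4) (uvBaseQ' klCutoffX5 klE0 4)) +
            (1 / 4 * Real.sqrt (216 * (1 / klE0 + 1 / 2)) *
                ∑ e : Fin 2 × Fin 2, (uvLinV klE0 (1 + (e.1 : ℕ) + (e.2 : ℕ)) *
                    (klCutoffX5 * ((1 + ((e.1 : ℕ) + (e.2 : ℕ)) + 2).factorial : ℝ) * (4 / klE0) ^ (1 + ((e.1 : ℕ) + (e.2 : ℕ)) + 1)) +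
                  uvLinD klE0 (1 + (e.1 : ℕ) + (e.2 : ℕ)) *
                    (klCutoffX5 * ((1 + ((e.1 : ℕ) + (e.2 : ℕ)) + 3).factorial : ℝ) * (4 / klE0) ^ (1 + ((e.1 : ℕ) + (e.2 : ℕ)) + 2)))) *
              (4608 * (1 + R.Gfr 0 + R.Gfr 1 + R.Gfr 2 + R.Gfr 3) ^ 4 * (((Nsc : ℝ) + 1) * U ^ 2 + 2 * |U|))) ≤ klE3A1 R := by
  have h3 := klE3Y_nonneg
  have hG : 0 ≤ 4608 * (1 + R.Gfr 0 + R.Gfr 1 + R.Gfr 2 + R.Gfr 3) ^ 4 := by positivity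
  have hkey : 4608 * (1 + R.Gfr 0 + R.Gfr 1 + R.Gfr 2 + R.Gfr 3) ^ 4 * (((Nsc : ℝ) + 1) * U ^ 2 + 2 * |U|) ≤
      4608 * (1 + R.Gfr 0 + R.Gfr 1 + R.Gfr 2 + R.Gfr 3) ^ 4 * 3 := mul_le_mul_of_nonneg_left hNU hG
  have hmono := mul_le_mul_of_nonneg_left hkey h3
  unfold klE3A1
  linarith [hmono]

/-- **`gridLabelWt`-weighted ROW sums `≤ (N/β)·klE3A1 R`** of `G_L^K` at an admissible frame. -/
theorem rowWt_frame_le_klE3A1 (hK : FrameOK R U Nsc μ K) (hR : R.WF) (hU1 : |U| ≤ 1)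
    (hNU : ((Nsc : ℝ) + 1) * U ^ 2 + 2 * |U| ≤ 3) (hβ : klBetaMin ≤ β) (hL : klEngL₃ β U ≤ L) (hM : klEngM₃ β U L ≤ M)
    (X : GridLeg (GridPoint L (2 * (2 * M)))) :
    ∑ Y : GridLeg (GridPoint L (2 * (2 * M))),
        ‖((hubbardGridSub L M β (2 * (2 * M))).transpose * hubbardCovAboveCT L M β μ 0 K klE0 * hubbardGridSub L M β (2 * (2 * M))) X Y‖ *
          gridLabelWt L (2 * (2 * M)) β {gridLegPos X, gridLegPos Y} ≤ ((2 * (2 * M) : ℕ) : ℝ) / β * klE3A1 R := by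
  have hβ0 : 0 < β := lt_of_lt_of_le (by norm_num [klBetaMin]) hβ
  refine (rowSum_scaleZero_gridLabelWt_le_X5 hK hR hU1 hβ hL hM X).trans ?_
  exact mul_le_mul_of_nonneg_left (frameAlphaOne_le_klE3A1 R hNU) (div_nonneg (Nat.cast_nonneg _) hβ0.le)

/-- **`gridLabelWt`-weighted COLUMN sums `≤ (N/β)·klE3A1 R`.** -/
theorem colWt_frame_le_klE3A1 (hK : FrameOK R U Nsc μ K) (hR : R.WF) (hU1 : |U| ≤ 1)
    (hNU : ((Nsc : ℝ) + 1) * U ^ 2 + 2 * |U| ≤ 3) (hβ : klBetaMin ≤ β) (hL : klEngL₃ β U ≤ L) (hM : klEngM₃ β U L ≤ M)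
    (Y : GridLeg (GridPoint L (2 * (2 * M)))) :
    ∑ X : GridLeg (GridPoint L (2 * (2 * M))),
        ‖((hubbardGridSub L M β (2 * (2 * M))).transpose * hubbardCovAboveCT L M β μ 0 K klE0 * hubbardGridSub L M β (2 * (2 * M))) X Y‖ *
          gridLabelWt L (2 * (2 * M)) β {gridLegPos X, gridLegPos Y} ≤ ((2 * (2 * M) : ℕ) : ℝ) / β * klE3A1 R := by
  have hβ0 : 0 < β := lt_of_lt_of_le (by norm_num [klBetaMin]) hβ
  refine (colSum_scaleZero_gridLabelWt_le_X5 hK hR hU1 hβ hL hM Y).trans ?_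
  exact mul_le_mul_of_nonneg_left (frameAlphaOne_le_klE3A1 R hNU) (div_nonneg (Nat.cast_nonneg _) hβ0.le)

/-- **`(1 + tnorm)`-weighted ROW sums `≤ (N/β)·klE3A1 R`.** -/
theorem rowOneAddTnorm_frame_le_klE3A1 (hK : FrameOK R U Nsc μ K) (hR : R.WF) (hU1 : |U| ≤ 1)
    (hNU : ((Nsc : ℝ) + 1) * U ^ 2 + 2 * |U| ≤ 3) (hβ : klBetaMin ≤ β) (hL : klEngL₃ β U ≤ L) (hM : klEngM₃ β U L ≤ M)
    (X : GridLeg (GridPoint L (2 * (2 * M)))) :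
    ∑ Y : GridLeg (GridPoint L (2 * (2 * M))),
        ‖((hubbardGridSub L M β (2 * (2 * M))).transpose * hubbardCovAboveCT L M β μ 0 K klE0 * hubbardGridSub L M β (2 * (2 * M))) X Y‖ *
          (1 + (Torus.tnorm (X.1.1.2 - Y.1.1.2) : ℝ)) ≤ ((2 * (2 * M) : ℕ) : ℝ) / β * klE3A1 R := by
  have hβ0 : 0 < β := lt_of_lt_of_le (by norm_num [klBetaMin]) hβ
  exact (sum_le_sum fun Y _ => mul_le_mul_of_nonneg_left (one_add_tnorm_le_gridLabelWt_pair hβ0.le X Y) (norm_nonneg _)).trans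
    (rowWt_frame_le_klE3A1 hK hR hU1 hNU hβ hL hM X)

/-- **`(1 + tnorm)`-weighted COLUMN sums `≤ (N/β)·klE3A1 R`.** -/
theorem colOneAddTnorm_frame_le_klE3A1 (hK : FrameOK R U Nsc μ K) (hR : R.WF) (hU1 : |U| ≤ 1)
    (hNU : ((Nsc : ℝ) + 1) * U ^ 2 + 2 * |U| ≤ 3) (hβ : klBetaMin ≤ β) (hL : klEngL₃ β U ≤ L) (hM : klEngM₃ β U L ≤ M)
    (Y : GridLeg (GridPoint L (2 * (2 * M)))) :
    ∑ X : GridLeg (GridPoint L (2 * (2 * M))),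
        ‖((hubbardGridSub L M β (2 * (2 * M))).transpose * hubbardCovAboveCT L M β μ 0 K klE0 * hubbardGridSub L M β (2 * (2 * M))) X Y‖ *
          (1 + (Torus.tnorm (X.1.1.2 - Y.1.1.2) : ℝ)) ≤ ((2 * (2 * M) : ℕ) : ℝ) / β * klE3A1 R := by
  have hβ0 : 0 < β := lt_of_lt_of_le (by norm_num [klBetaMin]) hβ
  exact (sum_le_sum fun X _ => mul_le_mul_of_nonneg_left (one_add_tnorm_le_gridLabelWt_pair hβ0.le X Y) (norm_nonneg _)).trans
    (colWt_frame_le_klE3A1 hK hR hU1 hNU hβ hL hM Y)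

/-- **Plain ROW sums `≤ (N/β)·klE3A1 R`.** -/
theorem row_frame_le_klE3A1 (hK : FrameOK R U Nsc μ K) (hR : R.WF) (hU1 : |U| ≤ 1)
    (hNU : ((Nsc : ℝ) + 1) * U ^ 2 + 2 * |U| ≤ 3) (hβ : klBetaMin ≤ β) (hL : klEngL₃ β U ≤ L) (hM : klEngM₃ β U L ≤ M)
    (X : GridLeg (GridPoint L (2 * (2 * M)))) :
    ∑ Y : GridLeg (GridPoint L (2 * (2 * M))),
        ‖((hubbardGridSub L M β (2 * (2 * M))).transpose * hubbardCovAboveCT L M β μ 0 K klE0 * hubbardGridSub L M β (2 * (2 * M))) X Y‖ ≤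
      ((2 * (2 * M) : ℕ) : ℝ) / β * klE3A1 R := by
  refine le_trans (sum_le_sum fun Y _ => ?_) (rowOneAddTnorm_frame_le_klE3A1 hK hR hU1 hNU hβ hL hM X)
  have h0 := norm_nonneg (((hubbardGridSub L M β (2 * (2 * M))).transpose * hubbardCovAboveCT L M β μ 0 K klE0 *
    hubbardGridSub L M β (2 * (2 * M))) X Y)
  have h1 : (0 : ℝ) ≤ (Torus.tnorm (X.1.1.2 - Y.1.1.2) : ℝ) := Nat.cast_nonneg _
  nlinarith

/-- **`tnorm`-weighted ROW sums (first moments) `≤ (N/β)·klE3A1 R`.** -/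
theorem rowTnorm_frame_le_klE3A1 (hK : FrameOK R U Nsc μ K) (hR : R.WF) (hU1 : |U| ≤ 1)
    (hNU : ((Nsc : ℝ) + 1) * U ^ 2 + 2 * |U| ≤ 3) (hβ : klBetaMin ≤ β) (hL : klEngL₃ β U ≤ L) (hM : klEngM₃ β U L ≤ M)
    (X : GridLeg (GridPoint L (2 * (2 * M)))) :
    ∑ Y : GridLeg (GridPoint L (2 * (2 * M))),
        ‖((hubbardGridSub L M β (2 * (2 * M))).transpose * hubbardCovAboveCT L M β μ 0 K klE0 * hubbardGridSub L M β (2 * (2 * M))) X Y‖ *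
          (Torus.tnorm (X.1.1.2 - Y.1.1.2) : ℝ) ≤ ((2 * (2 * M) : ℕ) : ℝ) / β * klE3A1 R := by
  refine le_trans (sum_le_sum fun Y _ => ?_) (rowOneAddTnorm_frame_le_klE3A1 hK hR hU1 hNU hβ hL hM X)
  have h0 := norm_nonneg (((hubbardGridSub L M β (2 * (2 * M))).transpose * hubbardCovAboveCT L M β μ 0 K klE0 *
    hubbardGridSub L M β (2 * (2 * M))) X Y)
  nlinarith

/-- **`(1 + reduced tnorm)`-weighted ROW sums `≤ (N/β)·klE3A1 R`** (coarse torus distance of the residues mod `Lc ∣ L` — the interaction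
bracket's weight `αw` of the two-volume STEP on nested tori). -/
theorem rowOneAddTnormReduce_frame_le_klE3A1 {Lc : ℕ} [NeZero Lc] (hLc : Lc ∣ L) (hK : FrameOK R U Nsc μ K) (hR : R.WF)
    (hU1 : |U| ≤ 1) (hNU : ((Nsc : ℝ) + 1) * U ^ 2 + 2 * |U| ≤ 3) (hβ : klBetaMin ≤ β) (hL : klEngL₃ β U ≤ L) (hM : klEngM₃ β U L ≤ M)
    (X : GridLeg (GridPoint L (2 * (2 * M)))) :
    ∑ Y : GridLeg (GridPoint L (2 * (2 * M))),
        ‖((hubbardGridSub L M β (2 * (2 * M))).transpose * hubbardCovAboveCT L M β μ 0 K klE0 * hubbardGridSub L M β (2 * (2 * M))) X Y‖ *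
          (1 + (Torus.tnorm ((fun i => (((X.1.1.2 i).val : ℕ) : ZMod Lc)) - fun i => (((Y.1.1.2 i).val : ℕ) : ZMod Lc)) : ℝ)) ≤
      ((2 * (2 * M) : ℕ) : ℝ) / β * klE3A1 R := by
  refine le_trans (sum_le_sum fun Y _ => mul_le_mul_of_nonneg_left ?_ (norm_nonneg _)) (rowOneAddTnorm_frame_le_klE3A1 hK hR hU1 hNU hβ hL hM X)
  simp only [add_le_add_iff_left]
  exact_mod_cast tnorm_reduce_sub_reduce_le hLc _ _

/-- **`(1 + reduced tnorm)`-weighted COLUMN sums `≤ (N/β)·klE3A1 R`.** -/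
theorem colOneAddTnormReduce_frame_le_klE3A1 {Lc : ℕ} [NeZero Lc] (hLc : Lc ∣ L) (hK : FrameOK R U Nsc μ K) (hR : R.WF)
    (hU1 : |U| ≤ 1) (hNU : ((Nsc : ℝ) + 1) * U ^ 2 + 2 * |U| ≤ 3) (hβ : klBetaMin ≤ β) (hL : klEngL₃ β U ≤ L) (hM : klEngM₃ β U L ≤ M)
    (Y : GridLeg (GridPoint L (2 * (2 * M)))) :
    ∑ X : GridLeg (GridPoint L (2 * (2 * M))),
        ‖((hubbardGridSub L M β (2 * (2 * M))).transpose * hubbardCovAboveCT L M β μ 0 K klE0 * hubbardGridSub L M β (2 * (2 * M))) X Y‖ *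
          (1 + (Torus.tnorm ((fun i => (((X.1.1.2 i).val : ℕ) : ZMod Lc)) - fun i => (((Y.1.1.2 i).val : ℕ) : ZMod Lc)) : ℝ)) ≤
      ((2 * (2 * M) : ℕ) : ℝ) / β * klE3A1 R := by
  refine le_trans (sum_le_sum fun X _ => mul_le_mul_of_nonneg_left ?_ (norm_nonneg _)) (colOneAddTnorm_frame_le_klE3A1 hK hR hU1 hNU hβ hL hM Y)
  simp only [add_le_add_iff_left]
  exact_mod_cast tnorm_reduce_sub_reduce_le hLc _ _

/-- **Reduced-`tnorm`-weighted ROW sums `≤ (N/β)·klE3A1 R`** (the fine first moment `m₁′` in the pulled-back coarse distance). -/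
theorem rowTnormReduce_frame_le_klE3A1 {Lc : ℕ} [NeZero Lc] (hLc : Lc ∣ L) (hK : FrameOK R U Nsc μ K) (hR : R.WF)
    (hU1 : |U| ≤ 1) (hNU : ((Nsc : ℝ) + 1) * U ^ 2 + 2 * |U| ≤ 3) (hβ : klBetaMin ≤ β) (hL : klEngL₃ β U ≤ L) (hM : klEngM₃ β U L ≤ M)
    (X : GridLeg (GridPoint L (2 * (2 * M)))) :
    ∑ Y : GridLeg (GridPoint L (2 * (2 * M))),
        ‖((hubbardGridSub L M β (2 * (2 * M))).transpose * hubbardCovAboveCT L M β μ 0 K klE0 * hubbardGridSub L M β (2 * (2 * M))) X Y‖ *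
          (Torus.tnorm ((fun i => (((X.1.1.2 i).val : ℕ) : ZMod Lc)) - fun i => (((Y.1.1.2 i).val : ℕ) : ZMod Lc)) : ℝ) ≤
      ((2 * (2 * M) : ℕ) : ℝ) / β * klE3A1 R :=
  (sum_norm_mul_tnorm_reduce_le hLc _ X).trans (rowTnorm_frame_le_klE3A1 hK hR hU1 hNU hβ hL hM X)

/-- **All-times far ROW tails `≤ ((N/β)·klE3A1 R)/(R′+1)`.** -/
theorem farRow_frame_le_klE3A1 (hK : FrameOK R U Nsc μ K) (hR : R.WF) (hU1 : |U| ≤ 1)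
    (hNU : ((Nsc : ℝ) + 1) * U ^ 2 + 2 * |U| ≤ 3) (hβ : klBetaMin ≤ β) (hL : klEngL₃ β U ≤ L) (hM : klEngM₃ β U L ≤ M)
    (R' : ℕ) (X : GridLeg (GridPoint L (2 * (2 * M)))) :
    ∑ Y ∈ univ.filter (fun Y : GridLeg (GridPoint L (2 * (2 * M))) => R' < Torus.tnorm (X.1.1.2 - Y.1.1.2)),
        ‖((hubbardGridSub L M β (2 * (2 * M))).transpose * hubbardCovAboveCT L M β μ 0 K klE0 * hubbardGridSub L M β (2 * (2 * M))) X Y‖ ≤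
      ((2 * (2 * M) : ℕ) : ℝ) / β * klE3A1 R / ((R' : ℝ) + 1) :=
  sum_far_norm_le_of_weightedRow _ R' X (rowOneAddTnorm_frame_le_klE3A1 hK hR hU1 hNU hβ hL hM X)

/-- **Sup entry `‖G_L^K X Y‖ ≤ 2(7+6047)`** at an admissible frame, `klBetaMin ≤ β ≤ L` (the Gram property). -/
theorem norm_frame_apply_le (hK : FrameOK R U Nsc μ K) (hβ : klBetaMin ≤ β) (hβL : β ≤ L) (X Y : GridLeg (GridPoint L (2 * (2 * M)))) :
    ‖((hubbardGridSub L M β (2 * (2 * M))).transpose * hubbardCovAboveCT L M β μ 0 K klE0 * hubbardGridSub L M β (2 * (2 * M))) X Y‖ ≤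
      2 * (7 + 6047) := by
  have h := norm_gridSub_hubbardCovAboveCT_apply_le_of_isGramBoundedR (L := L) (M := M) (N := 2 * (2 * M)) μ K klE0
    (isGramBoundedR_scaleZero_of_frameOK_sharp (L := L) (M := M) hK hβ hβL) X Y
  rwa [Real.sq_sqrt (by norm_num)] at h

end Rows

/-! ## §2 The counterterm slot and the grid data (Gram, unit, weighted profile) at an admissible frame -/

section Data

variable {L M : ℕ} [NeZero L] [NeZero M] {R : RenConsts} {U μ β : ℝ} {Nsc : ℕ} {K : TrigPolyC4v}

omit [NeZero M] in
/-- **The counterterm slot of the grid vertex profile at an admissible frame**: `(|β|/N)·Σ_z‖Ǩ_L z‖(1+|z|) ≤ (|β|/N)·k̄K(R, U, Nsc)`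
(`frameKernel_weightedL1_le`). -/
theorem vertexSlot_one_le_of_frameOK (hR : R.WF) (hU0 : U ≠ 0) (hU1 : |U| ≤ 1) (hK : FrameOK R U Nsc μ K) (N : ℕ) :
    |β| / N * ∑ z : TorusSite 2 L, ‖framePosKernel L K z‖ * (1 + torusSiteDist z 0) ≤
      |β| / N * (klKappaFrameC R * |U| + 2 * (((Nsc : ℝ) + 1) * U ^ 2 *
        (6 * (Real.pi * R.Gfr 1 / 2 + Real.pi ^ 2 * R.Gfr 2 / (2 * Real.sqrt 2) + Real.pi ^ 3 * R.Gfr 3 / 8)))) :=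
  mul_le_mul_of_nonneg_left (frameKernel_weightedL1_le hR hU0 hU1 hK) (by positivity)

/-- **ONE-VOLUME SCALE-`0` GRID DATA AT AN ADMISSIBLE FRAME** (frame-`K` twin of `scaleZero_gridData`, WITH the grid counterterm `𝒩_K`):
Gram property (`κ₀ = √(2(7+6047))`), unit grid partition function and the `(1+diam_{tnorm})`-weighted pinned profile of
`effAction G_L^K (V_N + 𝒩_K)`, from the `gridLabelWt`-weighted rows/columns `≤ αw` and `θ = e·αw·normV(κ₀, ρ, Nv_K)/κ₀² < 1`. -/
theorem frame_gridData (hK : FrameOK R U Nsc μ K) (hβ : klBetaMin ≤ β) (hβL : β ≤ L)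
    {αw : ℝ} (hαw : 0 < αw)
    (hrow : ∀ X, ∑ Y, ‖((hubbardGridSub L M β (2 * (2 * M))).transpose * hubbardCovAboveCT L M β μ 0 K klE0 *
        hubbardGridSub L M β (2 * (2 * M))) X Y‖ * gridLabelWt L (2 * (2 * M)) β {gridLegPos X, gridLegPos Y} ≤ αw)
    (hcol : ∀ Y, ∑ X, ‖((hubbardGridSub L M β (2 * (2 * M))).transpose * hubbardCovAboveCT L M β μ 0 K klE0 *
        hubbardGridSub L M β (2 * (2 * M))) X Y‖ * gridLabelWt L (2 * (2 * M)) β {gridLegPos X, gridLegPos Y} ≤ αw)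
    {ρ : ℝ} (hρ : 0 < ρ)
    (hθ : Real.exp 1 * αw * normV (GridLeg (GridPoint L (2 * (2 * M)))) (Real.sqrt (2 * (7 + 6047))) ρ
      (fun m' : ℕ => if m' = 1 then |β| / (2 * (2 * M) : ℕ) * ∑ z : TorusSite 2 L, ‖framePosKernel L K z‖ * (1 + torusSiteDist z 0)
        else if m' = 2 then |U| * |β| / (2 * (2 * M) : ℕ) else 0) / Real.sqrt (2 * (7 + 6047)) ^ 2 < 1) :
    IsGramBoundedR ((hubbardGridSub L M β (2 * (2 * M))).transpose * hubbardCovAboveCT L M β μ 0 K klE0 *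
        hubbardGridSub L M β (2 * (2 * M))) (Real.sqrt (2 * (7 + 6047))) ∧
      IsUnit (effPartitionFn ℂ ((hubbardGridSub L M β (2 * (2 * M))).transpose * hubbardCovAboveCT L M β μ 0 K klE0 *
        hubbardGridSub L M β (2 * (2 * M))) (hubbardGridInteraction L (2 * (2 * M)) β U + hubbardGridCounterQuadratic L (2 * (2 * M)) β K)) ∧
      ∀ (m' : ℕ) (j : Fin (2 * m')) (x : GridLeg (GridPoint L (2 * (2 * M)))),
        ∑ Y ∈ univ.filter (fun Y : Fin (2 * m') → GridLeg (GridPoint L (2 * (2 * M))) => Y j = x),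
          ‖kernel ℂ (effAction ℂ ((hubbardGridSub L M β (2 * (2 * M))).transpose * hubbardCovAboveCT L M β μ 0 K klE0 *
              hubbardGridSub L M β (2 * (2 * M))) (hubbardGridInteraction L (2 * (2 * M)) β U + hubbardGridCounterQuadratic L (2 * (2 * M)) β K))
              (2 * m') Y‖ *
            (1 + labelDiam (fun Y₁ Y₂ : GridLeg (GridPoint L (2 * (2 * M))) => (Torus.tnorm (Y₁.1.1.2 - Y₂.1.1.2) : ℝ)) (univ.image Y)) ≤
          ρ⁻¹ ^ (2 * m') * (Real.exp 1 * normV (GridLeg (GridPoint L (2 * (2 * M)))) (Real.sqrt (2 * (7 + 6047))) ρ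
            (fun m' : ℕ => if m' = 1 then |β| / (2 * (2 * M) : ℕ) * ∑ z : TorusSite 2 L, ‖framePosKernel L K z‖ * (1 + torusSiteDist z 0)
              else if m' = 2 then |U| * |β| / (2 * (2 * M) : ℕ) else 0)) /
            (1 - Real.exp 1 * αw * normV (GridLeg (GridPoint L (2 * (2 * M)))) (Real.sqrt (2 * (7 + 6047))) ρ
              (fun m' : ℕ => if m' = 1 then |β| / (2 * (2 * M) : ℕ) * ∑ z : TorusSite 2 L, ‖framePosKernel L K z‖ * (1 + torusSiteDist z 0)
                else if m' = 2 then |U| * |β| / (2 * (2 * M) : ℕ) else 0) / Real.sqrt (2 * (7 + 6047)) ^ 2) := by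
  classical
  set G := (hubbardGridSub L M β (2 * (2 * M))).transpose * hubbardCovAboveCT L M β μ 0 K klE0 * hubbardGridSub L M β (2 * (2 * M)) with hG
  have hβ0 : 0 ≤ β := le_trans (by norm_num [klBetaMin]) hβ
  have hGB : IsGramBoundedR G (Real.sqrt (2 * (7 + 6047))) := isGramBoundedR_scaleZero_of_frameOK_sharp (L := L) (M := M) hK hβ hβL
  have hκ : 0 < Real.sqrt (2 * (7 + 6047)) := Real.sqrt_pos.2 (by norm_num)
  have hrow' : ∀ X, ∑ Y, ‖G X Y‖ * (1 + (Torus.tnorm (X.1.1.2 - Y.1.1.2) : ℝ)) ≤ αw := fun X =>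
    (sum_le_sum fun Y _ => mul_le_mul_of_nonneg_left (one_add_tnorm_le_gridLabelWt_pair hβ0 X Y) (norm_nonneg _)).trans (hrow X)
  have hcol' : ∀ Y, ∑ X, ‖G X Y‖ * (1 + (Torus.tnorm (X.1.1.2 - Y.1.1.2) : ℝ)) ≤ αw := fun Y =>
    (sum_le_sum fun X _ => mul_le_mul_of_nonneg_left (one_add_tnorm_le_gridLabelWt_pair hβ0 X Y) (norm_nonneg _)).trans (hcol Y)
  obtain ⟨hZ, hprof⟩ := isUnit_and_weightedProfile_of_gridData (L := L) (Ng := 2 * (2 * M)) G hκ hGB β U K hαw hrow' hcol' hρ hθ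
  exact ⟨hGB, hZ, hprof⟩

end Data

end Summit.HubbardSuperconductivity.HubbardSuperconductivity.Theorems.TwoVolumeDefect

end
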